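/-
Copyright (c) 2026 the pub-hodgecm-mathlib formalisation cell (harness21).  Prover seat hodgecm-mathlib-F0P3a-p04 (g12); (F8) PROP. 13 item (13-i) «CORE-0» named by
A-p03 (g24) pen 1 (2026-09-01 04:39:15Z (B)); LEAD F0P3a-plan (g9) WORD T8-51 (C); architect A-p06 (g26) MAP v3 (F7)∕(F8).
-/
import Literature.NumberTheory.Automorphic.UnitaryThreeBorelConjugateCongruences
import HarnessLib

/-!
# Flicker's Prop. 13 (`θ̄ = 0 = j`), LAYER B CORE-0: the regimes of the four congruences as valuation lemmas in `(n = uσu, x)`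

Topic `NumberTheory/Automorphic` (road «D-N7-inert», MAP v3 (F7)∕(F8), the «long pole»); namespace `Literature.NumberTheory.Automorphic.UnitaryGroup`; the frame
and currency of ★ A-p03's core `UnitaryThreeBorelConjugateCongruences` (valued field `K`, `σ`, `LocalConjDatum σ ϖ`: `|ϖ| = exp(−1)`, `|2| = 1`, `σ` an isometric
involution).  THEOREMS ONLY: no definition, no named fact, no instance, no notation, no `sorry`; kernel lane.

THE MATHEMATICS [Flicker1998UnitaryFL, Prop. 13 and its proof pp. 91–93].  At `j = 0` the torus element is `t₁` itself (`θ = 1`), so in the four membership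
conditions of ★ `borel_conj_mem_unitaryInt_iff` one has `B₁ = B₂ =: B` with `|B| = |ϖ^N|` (`B = −(a−c)∕2`, `N = ord(a − c)`), `s := A − b = ((a−b) + (c−b))∕2`,
`t = ϖ^m`; write `d := 2s∕B` (Flicker's `−2x`, p. 93).  CAUTION (A-p03 2026-09-01 05:08:33Z, ★ `map_ratio_sub_ratio`): `d` is NOT `σ`-fixed — `a, b, c` are
norm-one, not in `F` — its anti-fixed part has the exact size `|σd − d| = |ϖ^{N₁+N₂−N}|`; so we split `d∕2 = f + g`, `σf = f`, `σg = −g` (binders `hfg hσf hσg`; the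
caller takes `f, g` = half-sum ∕ half-difference of `d∕2` and `σ(d∕2)`) and carry `c₁ := f² − 1` (`|c₁| = |c₀|`, `c₀ := d²∕4 − 1 = 4(a−b)(c−b)∕(a−c)²`,
`|c₀| = |ϖ^{N₁+N₂−2N}|`, as soon as `|g| < |c₀|`: `v_sq_sub_one_eq_of_lt`).  For a `σ`-fixed unit `n = uσu` and an `x` with `σx = −x` (Flicker's `λ√D`):
* §1 the quadratic of condition (4) is a NORM MINUS A CONSTANT UP TO THE ANTI-FIXED DEFECT: `n²(1−x²) + dn + 1 = n²·(z·σz − c₁ + 2g n⁻¹)`, `z := n⁻¹ + f + x`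
  (`z σz = (n⁻¹ + f)² − x²`; Flicker p. 93 «`(ζ + x)² − Dλ² ∈ x² − 1 + π^{2m−N}R` … `Im(x) ∈ π^{2m−N}R_E`, so we may assume `x ∈ R`»); hence, once
  `|B|·|g| ≤ |t|²` — which (4) itself FORCES (`v_mul_le_sq_of_condition_four`: the anti-fixed part of (4); this is Flicker's «we must have `2m ≤ M + N`», p. 92,
  since `|B|·|g| = |ϖ^{N₁+N₂}|`) — (4) ⟺ `|B|·|z σz − c₁| ≤ |t|²` (`condition_four_iff_norm_sub`);
* §2 two valuation tools: `|f + x| ≤ r ⟺ |f| ≤ r ∧ |x| ≤ r` for `σf = f`, `σx = −x` (`|2| = 1`), and `|z σz| ≤ |ϖ^a| ⟺ |z| ≤ |ϖ^{⌈a∕2⌉}|`;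
* §3 THE REGIMES (each ONE statement; Flicker's ranges (b)∕(d) and (c)∕(e) differ only by `m ≤ N` vs `m > N`, which the statements do not see):
  (R-a) `2m ≤ N`, `2m ≤ ord s` ⇒ (2)(3)(4) hold for every `(n, x)` [case (a) and «`1` if `m = 0`»];
  (R-kill) `|B| < |s|`, `|t|² < |s|` ⇒ (4) fails [«if `N₊ < N`, (`N₊ <`) `2m`, there are no solutions», p. 93];
  (R-bd) `|f| ≤ 1`, `N ≤ 2m`, `|g|, |c₁| ≤ |ϖ^{2m−N}|` (i.e. `2m ≤ M`): (2)∧(3)∧(4) ⟺ `|n⁻¹ + f| ≤ |ϖ^{m−[N∕2]}| ∧ |x| ≤ |ϖ^{m−[N∕2]}|` [cases (b), (d):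
  «`(uū)⁻¹ ∈ −x + π^{m−[N∕2]}R` and `λ ∈ π^{m−[N∕2]}R`», pp. 92–93 — the shape counted by ★ `UnramifiedQuadraticNormCongruences` §1–§2];
  (R-ce) `|f| ≤ 1`, `N ≤ 2m`, `|g| ≤ |ϖ^{2m−N}| < |c₁| ≤ |ϖ^{2(m−N)}|` (i.e. `M < 2m ≤ M + N`): (2)∧(3)∧(4) ⟺ `|z σz − c₁| ≤ |ϖ^{2m−N}|`, and then `|z|² = |c₁|`,
  so `ord c₁ = M − N` is EVEN [cases (c), (e): «there is a solution precisely when `M − N` is even», the norm-residue step; sufficiency = ★ unramified norm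
  surjectivity, used by the COUNT file]; (R-far) = `v_mul_le_sq_of_condition_four`: `2m > N₁ + N₂` ⇒ no solution.
What (13-ii) COUNT-0 needs per `m` is exactly these solution-set shapes (the `x`-count is translation-invariant, so the shift by `g` is immaterial).  HONEST LABEL: HC_CM is proved only modulo the printed citations until rung 0 closes; this file
is valuation algebra and proves no letter.

## References
* [Flicker1998UnitaryFL] Y. Z. Flicker, *Elementary proof of the fundamental lemma for a unitary group*, Canad. J. Math. 50 (1998): Prop. 13 pp. 91–93, Prop. 10 p. 86, §1 p. 75.
* [Rogawski1990] J. D. Rogawski, *Automorphic Representations of Unitary Groups in Three Variables* (1990), §4.9 p. 55.  [Serre1979] J.-P. Serre, *Local Fields*, Ch. V §2.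
-/

set_option autoImplicit false

open scoped WithZero

namespace Literature.NumberTheory.Automorphic

namespace UnitaryGroup

open Literature.NumberTheory.Automorphic.HermitianLattice (LocalConjDatum)

variable {K : Type*} [Field K] [Valued K ℤᵐ⁰] {ϖ : K} (σ : K →+* K)

/-! ## §1 The quadratic of condition (4) at `j = 0`: a norm minus a constant, up to the anti-fixed defect -/

omit [Valued K ℤᵐ⁰] in
/-- **`n²(1 − x²) + 2(f+g)·n + 1 = n² · ((n⁻¹ + f + x)(n⁻¹ + f − x) − (f² − 1) + 2 g n⁻¹)`** for `n ≠ 0` (Flicker p. 93: dividing the fourth equation by `(uū)²`,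
«`(ζ + x)² − Dλ² ∈ x² − 1 + …`» with `ζ = (uū)⁻¹`, the anti-fixed part `g` of `d∕2` set aside). [cite: Flicker1998UnitaryFL, Prop. 13 p. 93] -/
theorem quadratic_eq_sq_mul_norm_sub {n x f g : K} (hn : n ≠ 0) :
    n ^ 2 * (1 - x ^ 2) + 2 * (f + g) * n + 1 = n ^ 2 * ((n⁻¹ + f + x) * (n⁻¹ + f - x) - (f ^ 2 - 1) + 2 * g * n⁻¹) := by
  field_simp
  ring

omit [Valued K ℤᵐ⁰] in
/-- `σ(n⁻¹ + f + x) = n⁻¹ + f − x` for `σ`-fixed `n, f` and `σx = −x`: the second factor of §1 is the CONJUGATE, so the product is the norm `z σz`.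
[cite: Flicker1998UnitaryFL, Prop. 13 p. 93] -/
theorem map_inv_add_add {n x f : K} (hσn : σ n = n) (hσf : σ f = f) (hσx : σ x = -x) : σ (n⁻¹ + f + x) = n⁻¹ + f - x := by
  rw [map_add, map_add, map_inv₀, hσn, hσf, hσx, sub_eq_add_neg]

/-- Absorption: if `|e| ≤ r` then `|u + e| ≤ r ⟺ |u| ≤ r`. [cite: Flicker1998UnitaryFL, Prop. 13 p. 92] -/
theorem v_add_le_iff_of_le {u e : K} {r : ℤᵐ⁰} (he : Valued.v e ≤ r) : Valued.v (u + e) ≤ r ↔ Valued.v u ≤ r := by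
  refine ⟨fun h => ?_, fun h => le_trans (Valuation.map_add _ _ _) (max_le h he)⟩
  have eu : u = (u + e) - e := by ring
  rw [eu]; exact le_trans (Valuation.map_sub _ _ _) (max_le h he)

/-- **CONDITION (4) AT `j = 0`, EXACT FORM**: for a `σ`-fixed unit `n`, `σx = −x`, `B ≠ 0` and `(A−b)∕B = f + g` (`σf = f`):
`|2(A−b) + B n⁻¹ + nB(1−x²)| ≤ |t|² ⟺ |B| · |z σz − (f² − 1) + 2 g n⁻¹| ≤ |t|²`, `z = n⁻¹ + f + x` (★ `condition_four_iff_quadratic` at `j = 0`, then §1).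
[cite: Flicker1998UnitaryFL, Prop. 13 p. 93; Prop. 10 p. 86] -/
theorem condition_four_iff_norm_sub_add {A b n B x f g : K} {m : ℕ} (hB0 : B ≠ 0) (hn : Valued.v n = 1) (hσn : σ n = n)
    (hfg : (A - b) / B = f + g) (hσf : σ f = f) (hσx : σ x = -x) :
    Valued.v (2 * (A - b) + B * n⁻¹ + n * B * (1 - x ^ 2)) ≤ Valued.v (ϖ ^ m) * Valued.v (ϖ ^ m) ↔
      Valued.v B * Valued.v ((n⁻¹ + f + x) * σ (n⁻¹ + f + x) - (f ^ 2 - 1) + 2 * g * n⁻¹) ≤ Valued.v (ϖ ^ m) * Valued.v (ϖ ^ m) := by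
  have hn0 : n ≠ 0 := fun h => by rw [h, map_zero] at hn; exact zero_ne_one hn
  have hB₁ : B = B * ϖ ^ (2 * 0) := by rw [mul_zero, pow_zero, mul_one]
  have hd2 : 2 * (A - b) / B = 2 * (f + g) := by rw [mul_div_assoc, hfg]
  rw [condition_four_iff_quadratic (A := A) (b := b) (x := x) (m := m) hB0 hn hB₁, show ϖ ^ (2 * 0) = (1 : K) by rw [mul_zero, pow_zero], hd2,
    quadratic_eq_sq_mul_norm_sub hn0, ← map_inv_add_add σ hσn hσf hσx, map_mul (Valued.v) (n ^ 2), map_pow, hn, one_pow, one_mul]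

/-- **THE ANTI-FIXED PART OF (4) — Flicker's «we must have `2m ≤ M + N`»** (p. 92): for a `σ`-fixed unit `n`, `σx = −x`, `(A−b)∕B = f + g` with `σf = f`,
`σg = −g`, condition (4) forces `|B|·|g| ≤ |t|²` (the quadratic `E = n²(1−x²) + 2(f+g)n + 1` has `E − σE = 4gn`).  With `|B|·|g| = |ϖ^{N₁+N₂}|` (★ `map_ratio_sub_ratio`)
this is `2m ≤ N₁ + N₂`: beyond it there are NO solutions (Prop. 13's upper ends `[(M+N)∕2]`, and the empty regime `N₊ < N`, `N₊ < 2m`).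
[cite: Flicker1998UnitaryFL, Prop. 13 p. 92] -/
theorem v_mul_le_sq_of_condition_four (hd : LocalConjDatum σ ϖ) {A b n B x f g : K} {m : ℕ} (hB0 : B ≠ 0) (hn : Valued.v n = 1) (hσn : σ n = n)
    (hfg : (A - b) / B = f + g) (hσf : σ f = f) (hσg : σ g = -g) (hσx : σ x = -x)
    (h₄ : Valued.v (2 * (A - b) + B * n⁻¹ + n * B * (1 - x ^ 2)) ≤ Valued.v (ϖ ^ m) * Valued.v (ϖ ^ m)) :
    Valued.v B * Valued.v g ≤ Valued.v (ϖ ^ m) * Valued.v (ϖ ^ m) := by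
  have hB₁ : B = B * ϖ ^ (2 * 0) := by rw [mul_zero, pow_zero, mul_one]
  have hd2 : 2 * (A - b) / B = 2 * (f + g) := by rw [mul_div_assoc, hfg]
  rw [condition_four_iff_quadratic (A := A) (b := b) (x := x) (m := m) hB0 hn hB₁, show ϖ ^ (2 * 0) = (1 : K) by rw [mul_zero, pow_zero], hd2] at h₄
  set E : K := n ^ 2 * (1 - x ^ 2) + 2 * (f + g) * n + 1 with hE
  have hσE : σ E = n ^ 2 * (1 - x ^ 2) + 2 * (f - g) * n + 1 := by
    simp only [hE, map_add, map_mul, map_sub, map_pow, map_one, hσn, hσx, hσf, hσg, map_ofNat, neg_pow, even_two.neg_one_pow, one_mul]; ring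
  have eg : g = (E - σ E) * (4 * n)⁻¹ := by
    have hn0 : n ≠ 0 := fun h => by rw [h, map_zero] at hn; exact zero_ne_one hn
    have h4 : (4 : K) ≠ 0 := by
      rw [show (4 : K) = 2 * 2 by norm_num]
      exact mul_ne_zero (fun h => by have := hd.v2; rw [h, map_zero] at this; exact zero_ne_one this)
        (fun h => by have := hd.v2; rw [h, map_zero] at this; exact zero_ne_one this)
    rw [hσE, hE]; field_simp; ring
  have hv4n : Valued.v ((4 : K) * n)⁻¹ = 1 := by
    rw [map_inv₀, map_mul, show (4 : K) = 2 * 2 by norm_num, map_mul, hd.v2, hn, one_mul, one_mul, inv_one]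
  have hg : Valued.v g ≤ Valued.v E := by
    rw [eg, map_mul, hv4n, mul_one]
    exact le_trans (Valuation.map_sub _ _ _) (max_le (le_refl _) (by rw [hd.vσ]))
  exact le_trans (mul_le_mul' (le_refl _) hg) h₄

/-- **CONDITION (4) AT `j = 0` AS A NORM CONGRUENCE** (the defect absorbed): under `|B|·|g| ≤ |t|²`, (4) ⟺ `|B| · |z σz − (f² − 1)| ≤ |t|²`, `z = n⁻¹ + f + x`.
[cite: Flicker1998UnitaryFL, Prop. 13 pp. 92–93] -/
theorem condition_four_iff_norm_sub (hd : LocalConjDatum σ ϖ) {A b n B x f g : K} {m : ℕ} (hB0 : B ≠ 0) (hn : Valued.v n = 1) (hσn : σ n = n)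
    (hfg : (A - b) / B = f + g) (hσf : σ f = f) (hσx : σ x = -x) (hg : Valued.v B * Valued.v g ≤ Valued.v (ϖ ^ m) * Valued.v (ϖ ^ m)) :
    Valued.v (2 * (A - b) + B * n⁻¹ + n * B * (1 - x ^ 2)) ≤ Valued.v (ϖ ^ m) * Valued.v (ϖ ^ m) ↔
      Valued.v B * Valued.v ((n⁻¹ + f + x) * σ (n⁻¹ + f + x) - (f ^ 2 - 1)) ≤ Valued.v (ϖ ^ m) * Valued.v (ϖ ^ m) := by
  rw [condition_four_iff_norm_sub_add σ (A := A) (b := b) (x := x) (m := m) hB0 hn hσn hfg hσf hσx]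
  have hvB_pos : 0 < Valued.v B := (Valuation.pos_iff _).2 hB0
  have h2g : Valued.v B * Valued.v (2 * g * n⁻¹) ≤ Valued.v (ϖ ^ m) * Valued.v (ϖ ^ m) := by
    rw [map_mul, map_mul, hd.v2, one_mul, map_inv₀, hn, inv_one, mul_one]; exact hg
  constructor
  · intro h
    have e : (n⁻¹ + f + x) * σ (n⁻¹ + f + x) - (f ^ 2 - 1) = ((n⁻¹ + f + x) * σ (n⁻¹ + f + x) - (f ^ 2 - 1) + 2 * g * n⁻¹) - 2 * g * n⁻¹ := by ring
    rw [e]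
    calc Valued.v B * Valued.v (((n⁻¹ + f + x) * σ (n⁻¹ + f + x) - (f ^ 2 - 1) + 2 * g * n⁻¹) - 2 * g * n⁻¹)
        ≤ Valued.v B * max (Valued.v ((n⁻¹ + f + x) * σ (n⁻¹ + f + x) - (f ^ 2 - 1) + 2 * g * n⁻¹)) (Valued.v (2 * g * n⁻¹)) :=
          mul_le_mul' (le_refl _) (Valuation.map_sub _ _ _)
      _ ≤ Valued.v (ϖ ^ m) * Valued.v (ϖ ^ m) := by rw [mul_max]; exact max_le h h2g
  · intro h
    calc Valued.v B * Valued.v ((n⁻¹ + f + x) * σ (n⁻¹ + f + x) - (f ^ 2 - 1) + 2 * g * n⁻¹)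
        ≤ Valued.v B * max (Valued.v ((n⁻¹ + f + x) * σ (n⁻¹ + f + x) - (f ^ 2 - 1))) (Valued.v (2 * g * n⁻¹)) :=
          mul_le_mul' (le_refl _) (Valuation.map_add _ _ _)
      _ ≤ Valued.v (ϖ ^ m) * Valued.v (ϖ ^ m) := by rw [mul_max]; exact max_le h h2g

/-- `|f² − 1| = |(f + g)² − 1|` as soon as `|f|, |g| ≤ 1` and `|g| < |(f+g)² − 1|`: the constant `c₁ = f² − 1` of this file has the size of `c₀ = d²∕4 − 1 = 4(a−b)(c−b)∕(a−c)²`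
(`|c₀| = |ϖ^{N₁+N₂−2N}|`, while `|g| = |ϖ^{N₁+N₂−N}|`). [cite: Flicker1998UnitaryFL, Prop. 13 p. 93] -/
theorem v_sq_sub_one_eq_of_lt {f g : K} (hf : Valued.v f ≤ 1) (hg : Valued.v g ≤ 1) (hlt : Valued.v g < Valued.v ((f + g) ^ 2 - 1)) :
    Valued.v (f ^ 2 - 1) = Valued.v ((f + g) ^ 2 - 1) := by
  have e : f ^ 2 - 1 = ((f + g) ^ 2 - 1) - g * (f + (f + g)) := by ring
  have h1 : Valued.v (f + (f + g)) ≤ 1 :=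
    le_trans (Valuation.map_add _ _ _) (max_le hf (le_trans (Valuation.map_add _ _ _) (max_le hf hg)))
  have hsmall : Valued.v (g * (f + (f + g))) < Valued.v ((f + g) ^ 2 - 1) := by
    rw [map_mul]
    exact lt_of_le_of_lt (mul_le_mul' (le_refl _) h1) (by rw [mul_one]; exact hlt)
  rw [e]
  exact Valuation.map_sub_eq_of_lt_left _ hsmall

/-! ## §2 Two valuation tools -/

/-- **Fixed and anti-fixed parts separate in valuation** (`|2| = 1`, `σ` isometric): for `σf = f`, `σx = −x`, `|f + x| ≤ r ⟺ |f| ≤ r ∧ |x| ≤ r`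
(`2f = (f+x) + σ(f+x)`, `2x = (f+x) − σ(f+x)`). [cite: Flicker1998UnitaryFL, Prop. 13 p. 92] -/
theorem v_fixed_add_anti_le_iff (hd : LocalConjDatum σ ϖ) {f x : K} (hσf : σ f = f) (hσx : σ x = -x) (r : ℤᵐ⁰) :
    Valued.v (f + x) ≤ r ↔ Valued.v f ≤ r ∧ Valued.v x ≤ r := by
  refine ⟨fun h => ?_, fun h => le_trans (Valuation.map_add _ _ _) (max_le h.1 h.2)⟩
  have hσ : Valued.v (σ (f + x)) ≤ r := by rw [hd.vσ]; exact h
  have h20 : (2 : K) ≠ 0 := fun h0 => by have := hd.v2; rw [h0, map_zero] at this; exact zero_ne_one this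
  have ef : f = ((f + x) + σ (f + x)) * 2⁻¹ := by rw [map_add, hσf, hσx]; field_simp; ring
  have ex : x = ((f + x) - σ (f + x)) * 2⁻¹ := by rw [map_add, hσf, hσx]; field_simp; ring
  have h2i : Valued.v (2⁻¹ : K) = 1 := by rw [map_inv₀, hd.v2, inv_one]
  exact ⟨by rw [ef, map_mul, h2i, mul_one]; exact le_trans (Valuation.map_add _ _ _) (max_le h hσ),
    by rw [ex, map_mul, h2i, mul_one]; exact le_trans (Valuation.map_sub _ _ _) (max_le h hσ)⟩

/-- **`|z σz| ≤ |ϖ^a| ⟺ |z| ≤ |ϖ^{⌈a∕2⌉}|`** (`σ` isometric, so `|z σz| = |z|²`; valuations are integral powers of `exp(−1)`; `⌈a∕2⌉ = (a+1)∕2` in `ℕ`).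
[cite: Flicker1998UnitaryFL, Prop. 13 p. 92] -/
theorem v_mul_map_le_pow_iff (hd : LocalConjDatum σ ϖ) (z : K) (a : ℕ) :
    Valued.v (z * σ z) ≤ Valued.v (ϖ ^ a) ↔ Valued.v z ≤ Valued.v (ϖ ^ ((a + 1) / 2)) := by
  rw [map_mul, hd.vσ, hd.v_pow, hd.v_pow]
  by_cases hz : z = 0
  · simp only [hz, map_zero, zero_mul, zero_le]
  · have hv0 : Valued.v z ≠ 0 := (Valuation.ne_zero_iff _).2 hz
    rw [← WithZero.exp_log hv0, ← WithZero.exp_add, WithZero.exp_le_exp, WithZero.exp_le_exp]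
    omega

/-! ## §3 The regimes of Prop. 13 (`j = 0`)

Notation: `n` a `σ`-fixed unit, `x` with `σx = −x`, `B ≠ 0` with `|B| = |ϖ^N|` (both off-diagonal entries of `τ = t₁`), `t = ϖ^m`; «(2)(3)(4)» are the last three conditions of
★ `borel_conj_mem_unitaryInt_iff` at `B₁ = B₂ = B` (the first, `|nB| ≤ 1`, is automatic); `(A−b)∕B = f + g` (`σf = f`, `σg = −g`), `c₁ = f² − 1`. -/

/-- **(R-a) «everything solves»** (case (a), `1 ≤ m ≤ min([N∕2],[N₊∕2])`, and `m = 0`): if `|A − b| ≤ |t|²` and `|B| ≤ |t|²` then (2), (3), (4) hold for every unit `n`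
and integral `x`. [cite: Flicker1998UnitaryFL, Prop. 13 (a) p. 91, proof p. 93] -/
theorem conditions_of_le_sq (hd : LocalConjDatum σ ϖ) {A b n B x : K} {m : ℕ} (hn : Valued.v n = 1) (hx : Valued.v x ≤ 1)
    (hs : Valued.v (A - b) ≤ Valued.v (ϖ ^ m) * Valued.v (ϖ ^ m)) (hB : Valued.v B ≤ Valued.v (ϖ ^ m) * Valued.v (ϖ ^ m)) :
    Valued.v (A - b + n * B * (1 - x)) ≤ Valued.v (ϖ ^ m) ∧ Valued.v (A - b + n * B * (1 + x)) ≤ Valued.v (ϖ ^ m) ∧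
      Valued.v (2 * (A - b) + B * n⁻¹ + n * B * (1 - x ^ 2)) ≤ Valued.v (ϖ ^ m) * Valued.v (ϖ ^ m) := by
  have hsq : Valued.v (ϖ ^ m) * Valued.v (ϖ ^ m) ≤ Valued.v (ϖ ^ m) := by simpa using mul_le_mul' (hd.v_pow_le_one m) (le_refl (Valued.v (ϖ ^ m)))
  have hBt : Valued.v B ≤ Valued.v (ϖ ^ m) := le_trans hB hsq
  have hxB : Valued.v (n * B * x) ≤ Valued.v (ϖ ^ m) := by
    rw [map_mul, map_mul, hn, one_mul]; exact le_trans (by simpa using mul_le_mul' hBt hx) (le_refl _)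
  have hsB : Valued.v (A - b + n * B) ≤ Valued.v (ϖ ^ m) := by
    refine le_trans (Valuation.map_add _ _ _) (max_le (le_trans hs hsq) ?_)
    rw [map_mul, hn, one_mul]; exact hBt
  obtain ⟨h₂, h₃⟩ := two_congruences_of_v_le hxB hsB
  exact ⟨h₂, h₃, condition_four_of_le_sq σ hd (A := A) (b := b) (x := x) (j := 0) hn hx (show B = B * ϖ ^ (2 * 0) by rw [mul_zero, pow_zero, mul_one]) hs hB⟩

/-- **(R-kill) «no solutions once `|s|` dominates»** (`N₊ < N` with `N₊ < 2m`, p. 93: «if `N₊ < N`, `2m`, then there are no solutions»): if `|B| < |A − b|` and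
`|t|² < |A − b|` then (4) fails for every unit `n` and integral `x` — `|2(A−b)| = |A−b|` strictly dominates `|B n⁻¹ + nB(1−x²)| ≤ |B|`.
[cite: Flicker1998UnitaryFL, Prop. 13 p. 93] -/
theorem not_condition_four_of_v_lt (hd : LocalConjDatum σ ϖ) {A b n B x : K} {m : ℕ} (hn : Valued.v n = 1) (hx : Valued.v x ≤ 1)
    (hBs : Valued.v B < Valued.v (A - b)) (hts : Valued.v (ϖ ^ m) * Valued.v (ϖ ^ m) < Valued.v (A - b)) :
    ¬ Valued.v (2 * (A - b) + B * n⁻¹ + n * B * (1 - x ^ 2)) ≤ Valued.v (ϖ ^ m) * Valued.v (ϖ ^ m) := by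
  intro h₄
  have vX : Valued.v (2 * (A - b)) = Valued.v (A - b) := by rw [map_mul, hd.v2, one_mul]
  have hx2 : Valued.v (1 - x ^ 2) ≤ 1 :=
    le_trans (Valuation.map_sub _ _ _) (max_le (le_of_eq (map_one _)) (by rw [map_pow]; exact pow_le_one' hx 2))
  have vR : Valued.v (B * n⁻¹ + n * B * (1 - x ^ 2)) < Valued.v (2 * (A - b)) := by
    rw [vX]
    refine lt_of_le_of_lt (Valuation.map_add _ _ _) (max_lt ?_ ?_)
    · rw [map_mul, map_inv₀, hn, inv_one, mul_one]; exact hBs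
    · rw [map_mul, map_mul, hn, one_mul]
      exact lt_of_le_of_lt (by simpa using mul_le_mul' (le_refl (Valued.v B)) hx2) hBs
  have hsum : Valued.v (2 * (A - b) + B * n⁻¹ + n * B * (1 - x ^ 2)) = Valued.v (A - b) := by
    rw [add_assoc, Valuation.map_add_eq_of_lt_left _ vR, vX]
  rw [hsum] at h₄
  exact absurd (lt_of_lt_of_le hts h₄) (lt_irrefl _)

omit [Valued K ℤᵐ⁰] in
/-- Bookkeeping: `A − b + nB = B·(n + (A−b)∕B)` (`B ≠ 0`). [cite: Flicker1998UnitaryFL, Prop. 13 p. 92] -/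
theorem sub_add_mul_eq_mul_add {A b n B : K} (hB0 : B ≠ 0) : A - b + n * B = B * (n + (A - b) / B) := by
  field_simp
  ring

/-- (2) and (3) from `|B|·|x| ≤ |t|` and `|B|·|n + (A−b)∕B| ≤ |t|` (★ `two_congruences_of_v_le`). [cite: Flicker1998UnitaryFL, Prop. 13 p. 92] -/
theorem two_congruences_of_v_mul_le {A b n B x : K} {m : ℕ} (hB0 : B ≠ 0) (hn : Valued.v n = 1)
    (hxB : Valued.v B * Valued.v x ≤ Valued.v (ϖ ^ m)) (hnB : Valued.v B * Valued.v (n + (A - b) / B) ≤ Valued.v (ϖ ^ m)) :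
    Valued.v (A - b + n * B * (1 - x)) ≤ Valued.v (ϖ ^ m) ∧ Valued.v (A - b + n * B * (1 + x)) ≤ Valued.v (ϖ ^ m) := by
  refine two_congruences_of_v_le ?_ ?_
  · rw [map_mul, map_mul, hn, one_mul]; exact hxB
  · rw [sub_add_mul_eq_mul_add hB0, map_mul]; exact hnB

/-- Conversely (2) and (3) give `|B|·|x| ≤ |t|` and `|B|·|n + (A−b)∕B| ≤ |t|` (★ `v_le_of_two_congruences`). [cite: Flicker1998UnitaryFL, Prop. 13 p. 91] -/
theorem v_mul_le_of_two_congruences (hd : LocalConjDatum σ ϖ) {A b n B x : K} {m : ℕ} (hB0 : B ≠ 0) (hn : Valued.v n = 1)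
    (h₂ : Valued.v (A - b + n * B * (1 - x)) ≤ Valued.v (ϖ ^ m)) (h₃ : Valued.v (A - b + n * B * (1 + x)) ≤ Valued.v (ϖ ^ m)) :
    Valued.v B * Valued.v x ≤ Valued.v (ϖ ^ m) ∧ Valued.v B * Valued.v (n + (A - b) / B) ≤ Valued.v (ϖ ^ m) := by
  obtain ⟨hx, hs⟩ := v_le_of_two_congruences hd.v2 h₂ h₃
  rw [map_mul, map_mul, hn, one_mul] at hx
  rw [sub_add_mul_eq_mul_add hB0, map_mul] at hs
  exact ⟨hx, hs⟩

/-- `|B|·|y| ≤ |t|` from `|y| ≤ |ϖ^k|`, `|B| = |ϖ^N|`, `m ≤ N + k`. [cite: Flicker1998UnitaryFL, Prop. 13 p. 92] -/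
theorem v_mul_le_of_le_pow (hd : LocalConjDatum σ ϖ) {B y : K} {m N k : ℕ} (hB : Valued.v B = Valued.v (ϖ ^ N)) (hy : Valued.v y ≤ Valued.v (ϖ ^ k))
    (hk : m ≤ N + k) : Valued.v B * Valued.v y ≤ Valued.v (ϖ ^ m) :=
  calc Valued.v B * Valued.v y ≤ Valued.v (ϖ ^ N) * Valued.v (ϖ ^ k) := by rw [hB]; exact mul_le_mul' (le_refl _) hy
    _ ≤ Valued.v (ϖ ^ m) := by rw [← map_mul, ← pow_add, hd.v_pow, hd.v_pow, WithZero.exp_le_exp]; omega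

/-- **`|B|·|n + f + g| ≤ |t|` from the smallness of `n⁻¹ + f`** (the (2)(3)-half of the regimes (b)–(e)): with `|B| = |ϖ^N|`, `|n| = 1`, `|f| ≤ 1`,
`|n⁻¹ + f| ≤ |ϖ^k|`, `|f² − 1| ≤ |ϖ^{k′}|`, `|g| ≤ |ϖ^{k″}|` and `m ≤ N + k, N + k′, N + k″`: if `m ≤ N` this is `|n + f + g| ≤ 1`; if `m > N` then `k ≥ 1` forces `|f| = 1` and
`n + f = n f·((n⁻¹ + f) + (f⁻¹ − f))` with `|f⁻¹ − f| = |f² − 1|` (p. 92: «we may regard `a″∕B` as lying in `R`»). [cite: Flicker1998UnitaryFL, Prop. 13 p. 92] -/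
theorem v_mul_add_le (hd : LocalConjDatum σ ϖ) {n B f g : K} {m N k k' k'' : ℕ} (hB : Valued.v B = Valued.v (ϖ ^ N)) (hn : Valued.v n = 1)
    (hf1 : Valued.v f ≤ 1) (hf : Valued.v (n⁻¹ + f) ≤ Valued.v (ϖ ^ k)) (hc₁ : Valued.v (f ^ 2 - 1) ≤ Valued.v (ϖ ^ k'))
    (hg : Valued.v g ≤ Valued.v (ϖ ^ k'')) (hk : m ≤ N + k) (hk' : m ≤ N + k') (hk'' : m ≤ N + k'') :
    Valued.v B * Valued.v (n + (f + g)) ≤ Valued.v (ϖ ^ m) := by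
  have hn0 : n ≠ 0 := fun h => by rw [h, map_zero] at hn; exact zero_ne_one hn
  have hgB : Valued.v B * Valued.v g ≤ Valued.v (ϖ ^ m) := v_mul_le_of_le_pow σ hd hB hg hk''
  -- it suffices to bound `|B|·|n + f|`
  suffices hnf : Valued.v B * Valued.v (n + f) ≤ Valued.v (ϖ ^ m) by
    rw [← add_assoc]
    calc Valued.v B * Valued.v (n + f + g) ≤ Valued.v B * max (Valued.v (n + f)) (Valued.v g) := mul_le_mul' (le_refl _) (Valuation.map_add _ _ _)
      _ ≤ Valued.v (ϖ ^ m) := by rw [mul_max]; exact max_le hnf hgB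
  by_cases hmN : m ≤ N
  · have h1 : Valued.v (n + f) ≤ 1 := le_trans (Valuation.map_add _ _ _) (max_le hn.le hf1)
    calc Valued.v B * Valued.v (n + f) ≤ Valued.v (ϖ ^ N) * 1 := by rw [hB]; exact mul_le_mul' (le_refl _) h1
      _ ≤ Valued.v (ϖ ^ m) := by rw [mul_one, hd.v_pow, hd.v_pow, WithZero.exp_le_exp]; omega
  · push Not at hmN
    have hρ : Valued.v (ϖ ^ k) < 1 := by rw [hd.v_pow, ← WithZero.exp_zero, WithZero.exp_lt_exp]; omega
    have hni : Valued.v n⁻¹ = 1 := by rw [map_inv₀, hn, inv_one]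
    -- `|f| = 1`
    have hfv : Valued.v f = 1 := by
      by_contra hne
      have hlt : Valued.v f < Valued.v n⁻¹ := by rw [hni]; exact lt_of_le_of_ne hf1 hne
      have h1 : Valued.v (n⁻¹ + f) = 1 := by rw [Valuation.map_add_eq_of_lt_left _ hlt, hni]
      exact absurd (lt_of_le_of_lt hf hρ) (by rw [h1]; exact lt_irrefl _)
    have hf0 : f ≠ 0 := fun h => by rw [h, map_zero] at hfv; exact zero_ne_one hfv
    have e : n + f = (n * f) * ((n⁻¹ + f) + (f⁻¹ - f)) := by field_simp; ring
    have e' : f⁻¹ - f = -(f ^ 2 - 1) * f⁻¹ := by field_simp; ring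
    have hsmall : Valued.v ((n⁻¹ + f) + (f⁻¹ - f)) ≤ max (Valued.v (ϖ ^ k)) (Valued.v (ϖ ^ k')) := by
      refine le_trans (Valuation.map_add _ _ _) (max_le_max hf ?_)
      rw [e', map_mul, Valuation.map_neg, map_inv₀, hfv, inv_one, mul_one]; exact hc₁
    rw [e, map_mul, map_mul, hn, hfv, one_mul, one_mul, hB]
    rcases le_max_iff.1 hsmall with h | h
    · calc Valued.v (ϖ ^ N) * Valued.v (n⁻¹ + f + (f⁻¹ - f)) ≤ Valued.v (ϖ ^ N) * Valued.v (ϖ ^ k) := mul_le_mul' (le_refl _) h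
        _ ≤ Valued.v (ϖ ^ m) := by rw [← map_mul, ← pow_add, hd.v_pow, hd.v_pow, WithZero.exp_le_exp]; omega
    · calc Valued.v (ϖ ^ N) * Valued.v (n⁻¹ + f + (f⁻¹ - f)) ≤ Valued.v (ϖ ^ N) * Valued.v (ϖ ^ k') := mul_le_mul' (le_refl _) h
        _ ≤ Valued.v (ϖ ^ m) := by rw [← map_mul, ← pow_add, hd.v_pow, hd.v_pow, WithZero.exp_le_exp]; omega

/-- **(R-bd) THE BOUNDED REGIME** (cases (b) and (d): `N∕2 < m ≤ min(N, [M∕2])`, resp. `N < m ≤ [M∕2]`): for a `σ`-fixed unit `n`, `σx = −x`, `|B| = |ϖ^N|`, `N ≤ 2m`,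
`(A−b)∕B = f + g` (`σf = f`, `|f| ≤ 1`; `σg = −g`) with `|f² − 1| ≤ |ϖ^{2m−N}|` and `|g| ≤ |ϖ^{2m−N}|`: (2) ∧ (3) ∧ (4) ⟺ `|n⁻¹ + f| ≤ |ϖ^{m−[N∕2]}| ∧ |x| ≤ |ϖ^{m−[N∕2]}|`
— Flicker's «`(uū)⁻¹ ∈ −x + π^{m−[N∕2]}R`, `λ ∈ π^{m−[N∕2]}R`», whose count is `(1 + q⁻¹)q^{m+[N∕2]} · q^{m+[N∕2]}`. [cite: Flicker1998UnitaryFL, Prop. 13 (b)(d) pp. 91–93] -/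
theorem conditions_iff_v_le_of_bounded (hd : LocalConjDatum σ ϖ) {A b n B x f g : K} {m N : ℕ} (hB : Valued.v B = Valued.v (ϖ ^ N)) (hN : N ≤ 2 * m)
    (hn : Valued.v n = 1) (hσn : σ n = n) (hσx : σ x = -x) (hfg : (A - b) / B = f + g) (hσf : σ f = f) (hf1 : Valued.v f ≤ 1)
    (hc₁ : Valued.v (f ^ 2 - 1) ≤ Valued.v (ϖ ^ (2 * m - N))) (hg : Valued.v g ≤ Valued.v (ϖ ^ (2 * m - N))) :
    (Valued.v (A - b + n * B * (1 - x)) ≤ Valued.v (ϖ ^ m) ∧ Valued.v (A - b + n * B * (1 + x)) ≤ Valued.v (ϖ ^ m) ∧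
        Valued.v (2 * (A - b) + B * n⁻¹ + n * B * (1 - x ^ 2)) ≤ Valued.v (ϖ ^ m) * Valued.v (ϖ ^ m)) ↔
      Valued.v (n⁻¹ + f) ≤ Valued.v (ϖ ^ (m - N / 2)) ∧ Valued.v x ≤ Valued.v (ϖ ^ (m - N / 2)) := by
  have hB0 : B ≠ 0 := fun h => by rw [h, map_zero] at hB; exact (pow_ne_zero N hd.ϖ_ne_zero) ((Valuation.zero_iff _).1 hB.symm)
  have hσnf : σ (n⁻¹ + f) = n⁻¹ + f := by rw [map_add, map_inv₀, hσn, hσf]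
  have hBt : Valued.v B * Valued.v (ϖ ^ (2 * m - N)) = Valued.v (ϖ ^ m) * Valued.v (ϖ ^ m) := by
    rw [hB, ← map_mul, ← map_mul, ← pow_add, ← pow_add, show N + (2 * m - N) = m + m by omega]
  have hvB_pos : 0 < Valued.v B := (Valuation.pos_iff _).2 hB0
  have hgB : Valued.v B * Valued.v g ≤ Valued.v (ϖ ^ m) * Valued.v (ϖ ^ m) := by rw [← hBt]; exact mul_le_mul' (le_refl _) hg
  -- (4) ⟺ |z σz − c₁| ≤ |ϖ^{2m−N}| ⟺ |z σz| ≤ |ϖ^{2m−N}| ⟺ |z| ≤ |ϖ^{m−[N/2]}| ⟺ the two smallnesses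
  have h4 : Valued.v (2 * (A - b) + B * n⁻¹ + n * B * (1 - x ^ 2)) ≤ Valued.v (ϖ ^ m) * Valued.v (ϖ ^ m) ↔
      Valued.v (n⁻¹ + f) ≤ Valued.v (ϖ ^ (m - N / 2)) ∧ Valued.v x ≤ Valued.v (ϖ ^ (m - N / 2)) := by
    rw [condition_four_iff_norm_sub σ hd (A := A) (b := b) (x := x) (m := m) hB0 hn hσn hfg hσf hσx hgB, ← hBt, mul_le_mul_iff_right₀ hvB_pos,
      sub_eq_add_neg, v_add_le_iff_of_le (by rw [Valuation.map_neg]; exact hc₁), v_mul_map_le_pow_iff σ hd _ (2 * m - N),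
      show (2 * m - N + 1) / 2 = m - N / 2 by omega, v_fixed_add_anti_le_iff σ hd hσnf hσx]
  rw [h4]
  refine ⟨fun h => h.2.2, fun ⟨hf, hxs⟩ => ?_⟩
  obtain ⟨h₂, h₃⟩ := two_congruences_of_v_mul_le (A := A) (b := b) hB0 hn (v_mul_le_of_le_pow σ hd (m := m) (k := m - N / 2) hB hxs (by omega))
    (by rw [hfg]; exact v_mul_add_le σ hd (m := m) (k := m - N / 2) (k' := 2 * m - N) (k'' := 2 * m - N) hB hn hf1 hf hc₁ hg (by omega) (by omega) (by omega))
  exact ⟨h₂, h₃, hf, hxs⟩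

/-- **(R-ce) THE NORM-RESIDUE REGIME** (cases (c) and (e): `[M∕2] < m ≤ N`, resp. `max(N+1, [M∕2]+1) ≤ m ≤ [(M+N)∕2]`): for a `σ`-fixed unit `n`, `σx = −x`,
`|B| = |ϖ^N|`, `N ≤ 2m`, `(A−b)∕B = f + g` (`σf = f`, `|f| ≤ 1`, `|g| ≤ |ϖ^{2m−N}|`) and `c₁ = f² − 1` with `|ϖ^{2m−N}| < |c₁| ≤ |ϖ^{2(m−N)}|` (`M < 2m ≤ M + N`):
(2) ∧ (3) ∧ (4) ⟺ `|z σz − c₁| ≤ |ϖ^{2m−N}|`, `z = n⁻¹ + f + x` — Flicker's «`ζ₂² − Dλ₂² ∈ 1 + π^{2m−M}R`» after scaling, counted by norm fibres.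
[cite: Flicker1998UnitaryFL, Prop. 13 (c)(e) pp. 91–93] -/
theorem conditions_iff_norm_sub_le_of_near (hd : LocalConjDatum σ ϖ) {A b n B x f g : K} {m N : ℕ} (hB : Valued.v B = Valued.v (ϖ ^ N)) (hN : N ≤ 2 * m)
    (hn : Valued.v n = 1) (hσn : σ n = n) (hσx : σ x = -x) (hfg : (A - b) / B = f + g) (hσf : σ f = f) (hf1 : Valued.v f ≤ 1)
    (hg : Valued.v g ≤ Valued.v (ϖ ^ (2 * m - N))) (hnear : Valued.v (ϖ ^ (2 * m - N)) < Valued.v (f ^ 2 - 1))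
    (hfar : Valued.v (f ^ 2 - 1) ≤ Valued.v (ϖ ^ (2 * (m - N)))) :
    (Valued.v (A - b + n * B * (1 - x)) ≤ Valued.v (ϖ ^ m) ∧ Valued.v (A - b + n * B * (1 + x)) ≤ Valued.v (ϖ ^ m) ∧
        Valued.v (2 * (A - b) + B * n⁻¹ + n * B * (1 - x ^ 2)) ≤ Valued.v (ϖ ^ m) * Valued.v (ϖ ^ m)) ↔
      Valued.v ((n⁻¹ + f + x) * σ (n⁻¹ + f + x) - (f ^ 2 - 1)) ≤ Valued.v (ϖ ^ (2 * m - N)) := by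
  have hB0 : B ≠ 0 := fun h => by rw [h, map_zero] at hB; exact (pow_ne_zero N hd.ϖ_ne_zero) ((Valuation.zero_iff _).1 hB.symm)
  have hσnf : σ (n⁻¹ + f) = n⁻¹ + f := by rw [map_add, map_inv₀, hσn, hσf]
  have hBt : Valued.v B * Valued.v (ϖ ^ (2 * m - N)) = Valued.v (ϖ ^ m) * Valued.v (ϖ ^ m) := by
    rw [hB, ← map_mul, ← map_mul, ← pow_add, ← pow_add, show N + (2 * m - N) = m + m by omega]
  have hvB_pos : 0 < Valued.v B := (Valuation.pos_iff _).2 hB0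
  have hgB : Valued.v B * Valued.v g ≤ Valued.v (ϖ ^ m) * Valued.v (ϖ ^ m) := by rw [← hBt]; exact mul_le_mul' (le_refl _) hg
  have h4 : Valued.v (2 * (A - b) + B * n⁻¹ + n * B * (1 - x ^ 2)) ≤ Valued.v (ϖ ^ m) * Valued.v (ϖ ^ m) ↔
      Valued.v ((n⁻¹ + f + x) * σ (n⁻¹ + f + x) - (f ^ 2 - 1)) ≤ Valued.v (ϖ ^ (2 * m - N)) := by
    rw [condition_four_iff_norm_sub σ hd (A := A) (b := b) (x := x) (m := m) hB0 hn hσn hfg hσf hσx hgB, ← hBt, mul_le_mul_iff_right₀ hvB_pos]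
  rw [h4]
  refine ⟨fun h => h.2.2, fun h => ?_⟩
  -- from `|zσz − c₁| < |c₁|`: `|zσz| = |c₁| ≤ |ϖ^{2(m−N)}|`, so `|z| ≤ |ϖ^{m−N}|`
  have hzz : Valued.v ((n⁻¹ + f + x) * σ (n⁻¹ + f + x)) = Valued.v (f ^ 2 - 1) := by
    have e : (n⁻¹ + f + x) * σ (n⁻¹ + f + x) = ((n⁻¹ + f + x) * σ (n⁻¹ + f + x) - (f ^ 2 - 1)) + (f ^ 2 - 1) := by ring
    rw [e]
    exact Valuation.map_add_eq_of_lt_right _ (lt_of_le_of_lt h hnear)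
  have hz : Valued.v (n⁻¹ + f + x) ≤ Valued.v (ϖ ^ (m - N)) := by
    have := (v_mul_map_le_pow_iff σ hd (n⁻¹ + f + x) (2 * (m - N))).1 (by rw [hzz]; exact hfar)
    rwa [show (2 * (m - N) + 1) / 2 = m - N by omega] at this
  rw [v_fixed_add_anti_le_iff σ hd hσnf hσx] at hz
  obtain ⟨h₂, h₃⟩ := two_congruences_of_v_mul_le (A := A) (b := b) hB0 hn (v_mul_le_of_le_pow σ hd (m := m) (k := m - N) hB hz.2 (by omega))
    (by rw [hfg]; exact v_mul_add_le σ hd (m := m) (k := m - N) (k' := 2 * (m - N)) (k'' := 2 * m - N) hB hn hf1 hz.1 hfar hg (by omega) (by omega) (by omega))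
  exact ⟨h₂, h₃, h⟩

/-- **PARITY (the norm-residue obstruction, necessity)**: in the regime of `conditions_iff_norm_sub_le_of_near`, a solution forces `|c₁| = |z|²`, so `c₁` has EVEN order:
`|c₁| = exp(2e)` — Flicker's «there is a solution precisely when `M − N` is even» (`|c₁| = |ϖ^{M−N}|`; sufficiency is the unramified norm theorem, used by the count).
[cite: Flicker1998UnitaryFL, Prop. 13 (c)(e) pp. 92–93] [cite: Serre1979, Ch. V §2] -/
theorem even_of_norm_sub_le_of_near (hd : LocalConjDatum σ ϖ) {z c₁ : K} {a : ℕ} (hnear : Valued.v (ϖ ^ a) < Valued.v c₁)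
    (h : Valued.v (z * σ z - c₁) ≤ Valued.v (ϖ ^ a)) : ∃ e : ℤ, Valued.v c₁ = WithZero.exp (2 * e) := by
  have hzz : Valued.v (z * σ z) = Valued.v c₁ := by
    have e : z * σ z = (z * σ z - c₁) + c₁ := by ring
    rw [e]; exact Valuation.map_add_eq_of_lt_right _ (lt_of_le_of_lt h hnear)
  have hc0 : Valued.v c₁ ≠ 0 := ne_of_gt (lt_of_le_of_lt zero_le hnear)
  have hz0 : Valued.v z ≠ 0 := by
    intro h0
    rw [map_mul, hd.vσ, h0, zero_mul] at hzz; exact hc0 hzz.symm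
  obtain ⟨e, he⟩ : ∃ e : ℤ, Valued.v z = WithZero.exp e := ⟨_, (WithZero.exp_log hz0).symm⟩
  refine ⟨e, ?_⟩
  rw [← hzz, map_mul, hd.vσ, he, ← WithZero.exp_add, two_mul]

end UnitaryGroup

end Literature.NumberTheory.Automorphic
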